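import Literature.Topology.FourManifolds.CappellShanesonClassNumberOneLarge
import HarnessLib

/-!
# The cubic field of discriminant `2777` (Cappell–Shaneson trace `-5`): integers, small primes,
# their relations, and the class group `{1, [𝔭₅]}`

First file of the discharge of the named fact
`Literature.Topology.FourManifolds.aitchisonRubinstein1984_traceNegFiveClasses`
(`CappellShanesonTraceClasses.lean`): "There are two conjugacy classes of Cappell-Shaneson matrices
with trace `-5`, represented by `A₋₇` and `!![0, -5, -8; 0, 2, 3; 1, 0, -7]`" (Gompf, Algebr. Geom.
Topol. 10 (2010), Examples 3.1(b), citing Aitchison–Rubinstein, Contemp. Math. 35 (1984),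
Appendix, Table 1, row `a = -5`: `Δ(f₋₅) = 2777` prime, `R = R'`, `|C(R')| = 2`). By the
Latimer–MacDuffee–Taussky correspondence (conjugacy classes of integer matrices with characteristic
polynomial `f₋₅ = x³ + 5x² - 6x - 1` ↔ ideal classes of `ℤ[θ]`, `f₋₅(θ) = 0`) the fact is the
statement that the class group of the cubic field `K = ℚ(θ)` has exactly two elements, together
with the identification of the two matrix classes. This file supplies the ARITHMETIC of `K` that
the class-number computation consumes (Marcus, *Number Fields*, Ch. 3, Thm. 27 and Ch. 5, the
computations after Thm. 37), for any cubic number field `K` generated by a root `θ` of `f₋₅`: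

* `𝓞 K = ℤ[θ]` and `d_K = 2777` (`adjoin_thetaInt_eq_top_of_sq`, `discr_eq_csDisc_of_sq`): the
  lemmas of `CappellShanesonClassNumberOne.lean`, there stated for `-4 ≤ a ≤ 9`, hold verbatim under
  the only hypothesis their proofs use, namely that `Δ(f_a)` has no square factor `r² > 1` with
  cofactor `|e| > 2` — true for the prime `Δ(f₋₅) = 2777` (`csDisc_negFive_sq`);
* Dedekind–Kummer at the primes `p ≤ 14` (`14 ≥ ⌊M_K⌋`, next file): `2` and `11` are inert
  (`f₋₅` has no root mod `2, 11`); `f₋₅ ≡ (x - 2)(x² + 7x + 8) (mod 3)` gives the two primes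
  `𝔭₃ = (3, θ - 2)` and `𝔭₉ = (3, θ² + 7θ + 8)` above `3`; the primes of residue degree one above
  `5, 7, 13` are `𝔭₅ = (5, θ - 2)`, `𝔭₇ = (7, θ - 4)`, `𝔭₁₃ = (13, θ - 9)` (unique roots `2, 4, 9`),
  the other primes above `5, 7, 13` having norm `≥ p² > 14`;
* the multiplicative relations, each certified by explicit cofactors in `ℤ[θ]`
  (`span_pair_mul_span_pair_eq_span_singleton`):
  `𝔭₅² = (2θ + 1)`, `𝔭₃ 𝔭₅ = (θ - 2)`, `𝔭₅ 𝔭₇ = (θ + 3)`, `𝔭₅ 𝔭₁₃ = (3θ - 1)`, `𝔭₃ 𝔭₉ = (3)`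
  (norms `-25, -15, -35, 65, 27`).

Consequently (`classGroup_mem_pair_negFive`, via the Minkowski bound `⌊M_K⌋ ≤ 14` and the
generation lemma `classGroup_subgroup_eq_top_of_primesOver`) EVERY IDEAL CLASS OF `K` IS `1` OR
`[𝔭₅]`, with `[𝔭₅]² = 1`: the class number is at most `2`. That `[𝔭₅] ≠ 1` (class number exactly
`2`, the content of Table 1's entry) is proved in the sequel from Dirichlet's unit theorem.

## References

* [AitchisonRubinstein1984] I. R. Aitchison, J. H. Rubinstein, *Fibered knots and involutions on
  homotopy spheres*, Contemp. Math. 35 (1984), Appendix "Conjugacy in `SL(3, ℤ)`", Table 1 (row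
  `a = -5`: `Δ = 2777`, prime, `R = R'`, `|C(R')| = 2`) and Example `a = -5`.
* [GompfAGT2010] R. E. Gompf, *More Cappell–Shaneson spheres are standard*, Algebr. Geom. Topol. 10
  (2010) 1665–1681, Examples 3.1(b).
* [Marcus2018] D. A. Marcus, *Number Fields*, 2nd ed., Ch. 3, Thm. 27 (Dedekind–Kummer); Ch. 5,
  the computations after Thm. 37.
-/

noncomputable section

open Set Polynomial Module NumberField Ideal
open scoped NumberField

namespace Literature.Topology.FourManifolds

section Root

variable {K : Type*} [Field K] [NumberField K] {a : ℤ} {θ : K}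

/-! ### `𝓞 K = ℤ[θ]` and `d_K = Δ(f_a)` under the square-factor hypothesis on `Δ(f_a)` -/

/-- The index determinant of `1, θ, θ²` is a unit as soon as `Δ(f_a)` admits no factorisation
`Δ = r² e` with `|e| > 2` and `r ≠ ±1` (discriminant–index criterion; the form in which
`CappellShanesonClassNumberOne.lean` uses the hypothesis `-4 ≤ a ≤ 9`). [cite: Marcus2018, Ch. 2, Exercise 27(e)] -/
theorem isUnit_indexDet_csPB_of_sq (hθ : aeval θ (csPoly a) = 0) (h3 : finrank ℚ K = 3)
    (hsq : ∀ r e : ℤ, csDisc a = r ^ 2 * e → 2 < |e| → IsUnit r) :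
    IsUnit (Literature.NumberTheory.NumberFields.indexDet (csPB hθ h3) (isIntegral_csPB_gen hθ h3)) :=
  Literature.NumberTheory.NumberFields.isUnit_indexDet_of_discr_eq (csPB hθ h3)
    (isIntegral_csPB_gen hθ h3) (by rw [h3]; norm_num) (csDisc a) (discr_csPB hθ h3) hsq

/-- `𝓞 K = ℤ[θ]` under the square-factor hypothesis: every algebraic integer of `K` lies in
`ℤ[θ]`. [cite: Marcus2018, Ch. 2, Exercise 27(d),(e)] -/
theorem mem_adjoin_theta_of_sq (hθ : aeval θ (csPoly a) = 0) (h3 : finrank ℚ K = 3)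
    (hsq : ∀ r e : ℤ, csDisc a = r ^ 2 * e → 2 < |e| → IsUnit r) (x : 𝓞 K) :
    (x : K) ∈ Algebra.adjoin ℤ ({θ} : Set K) :=
  Literature.NumberTheory.NumberFields.mem_adjoin_of_isUnit_indexDet (csPB hθ h3)
    (isIntegral_csPB_gen hθ h3) (isUnit_indexDet_csPB_of_sq hθ h3 hsq) x

/-- `d_K = Δ(f_a)` under the square-factor hypothesis. [cite: Marcus2018, Ch. 2, Exercise 27(d)] -/
theorem discr_eq_csDisc_of_sq (hθ : aeval θ (csPoly a) = 0) (h3 : finrank ℚ K = 3)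
    (hsq : ∀ r e : ℤ, csDisc a = r ^ 2 * e → 2 < |e| → IsUnit r) :
    NumberField.discr K = csDisc a :=
  Literature.NumberTheory.NumberFields.discr_eq_of_isUnit_indexDet (csPB hθ h3)
    (isIntegral_csPB_gen hθ h3) (isUnit_indexDet_csPB_of_sq hθ h3 hsq) (csDisc a) (discr_csPB hθ h3)

/-- `𝓞 K = ℤ[θ]` as a subalgebra statement under the square-factor hypothesis: `thetaInt hθ`
generates `𝓞 K` as a `ℤ`-algebra. [cite: Marcus2018, Ch. 2, Exercise 27(d),(e)] -/
theorem adjoin_thetaInt_eq_top_of_sq (hθ : aeval θ (csPoly a) = 0) (h3 : finrank ℚ K = 3)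
    (hsq : ∀ r e : ℤ, csDisc a = r ^ 2 * e → 2 < |e| → IsUnit r) :
    Algebra.adjoin ℤ ({thetaInt hθ} : Set (𝓞 K)) = ⊤ := by
  refine Algebra.eq_top_iff.mpr fun x => ?_
  have hx := mem_adjoin_theta_of_sq hθ h3 hsq x
  let φ : 𝓞 K →ₐ[ℤ] K := (algebraMap (𝓞 K) K).toIntAlgHom
  have hmap : Algebra.adjoin ℤ ({θ} : Set K) =
      (Algebra.adjoin ℤ ({thetaInt hθ} : Set (𝓞 K))).map φ := by
    rw [AlgHom.map_adjoin, Set.image_singleton]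
    rfl
  rw [hmap, Subalgebra.mem_map] at hx
  obtain ⟨y, hy, hyx⟩ := hx
  have : y = x := IsFractionRing.injective (𝓞 K) K hyx
  rwa [← this]

/-- Hence Dedekind's criterion applies at every prime: the exponent of `thetaInt hθ` is `1`. [folklore] -/
theorem exponent_thetaInt_of_sq (hθ : aeval θ (csPoly a) = 0) (h3 : finrank ℚ K = 3)
    (hsq : ∀ r e : ℤ, csDisc a = r ^ 2 * e → 2 < |e| → IsUnit r) :
    RingOfIntegers.exponent (thetaInt hθ) = 1 :=
  RingOfIntegers.exponent_eq_one_iff.mpr (adjoin_thetaInt_eq_top_of_sq hθ h3 hsq)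

/-- **Dedekind–Kummer for `𝓞 K = ℤ[θ]`** under the square-factor hypothesis: a prime `P` of `𝓞 K`
above `p` is `(p, Q(θ))` for any integer lift `Q` of the corresponding monic irreducible factor
`Q̄ ∣ f_a mod p`, with residue degree `deg Q̄` (Marcus, Ch. 3, Thm. 27; Mathlib's
`NumberField.Ideal.primesOverSpanEquivMonicFactorsMod`). [cite: Marcus2018, Ch. 3, Thm. 27] -/
theorem exists_factor_of_mem_primesOver_of_sq (hθ : aeval θ (csPoly a) = 0) (h3 : finrank ℚ K = 3)
    (hsq : ∀ r e : ℤ, csDisc a = r ^ 2 * e → 2 < |e| → IsUnit r) {p : ℕ} (hp : p.Prime)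
    {P : Ideal (𝓞 K)} (hP : P ∈ primesOver (span {(p : ℤ)}) (𝓞 K)) :
    ∃ Qb : (ZMod p)[X], Irreducible Qb ∧ Qb.Monic ∧ Qb ∣ csPolyMod a p ∧
      P.inertiaDeg ℤ = Qb.natDegree ∧
      ∀ Q : ℤ[X], Q.map (Int.castRingHom (ZMod p)) = Qb →
        P = span {(p : 𝓞 K), aeval (thetaInt hθ) Q} := by
  haveI := Fact.mk hp
  have hexp : ¬ p ∣ RingOfIntegers.exponent (thetaInt hθ) := by
    rw [exponent_thetaInt_of_sq hθ h3 hsq, Nat.dvd_one]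
    exact hp.ne_one
  set e := NumberField.Ideal.primesOverSpanEquivMonicFactorsMod (K := K) hexp with he
  set Qb := e ⟨P, hP⟩ with hQb
  have hmem : (Qb : (ZMod p)[X]) ∈ RingOfIntegers.monicFactorsMod (thetaInt hθ) p := Qb.2
  have hmem' := hmem
  simp only [RingOfIntegers.monicFactorsMod, Multiset.mem_toFinset, minpoly_thetaInt hθ] at hmem'
  have h0 : csPolyMod a p ≠ 0 := (monic_csPolyMod a p).ne_zero
  obtain ⟨hirr, hmon, hdvd⟩ := (Polynomial.mem_normalizedFactors_iff h0).mp hmem'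
  refine ⟨Qb, hirr, hmon, hdvd, ?_, ?_⟩
  · have := NumberField.Ideal.inertiaDeg_primesOverSpanEquivMonicFactorsMod_symm_apply' hexp hmem
    rwa [show (⟨(Qb : (ZMod p)[X]), hmem⟩ : RingOfIntegers.monicFactorsMod (thetaInt hθ) p) = Qb
      from Subtype.ext rfl, Equiv.symm_apply_apply] at this
  · intro Q hQ
    have hmemQ : Q.map (Int.castRingHom (ZMod p)) ∈
        RingOfIntegers.monicFactorsMod (thetaInt hθ) p := hQ ▸ hmem
    have h1 := NumberField.Ideal.primesOverSpanEquivMonicFactorsMod_symm_apply_eq_span hexp hmemQ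
    have h2 : (⟨Q.map (Int.castRingHom (ZMod p)), hmemQ⟩ :
        RingOfIntegers.monicFactorsMod (thetaInt hθ) p) = Qb := Subtype.ext hQ
    rw [h2, hQb, Equiv.symm_apply_apply] at h1
    exact h1

/-- **Inert primes**: if `f_a` has no root modulo `p` (so the cubic `f_a mod p` is irreducible),
every prime of `𝓞 K` above `p` is `(p)`. [cite: Marcus2018, Ch. 3, Thm. 27] -/
theorem eq_span_of_no_root_of_sq (hθ : aeval θ (csPoly a) = 0) (h3 : finrank ℚ K = 3)
    (hsq : ∀ r e : ℤ, csDisc a = r ^ 2 * e → 2 < |e| → IsUnit r) {p : ℕ} (hp : p.Prime)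
    {P : Ideal (𝓞 K)} (hP : P ∈ primesOver (span {(p : ℤ)}) (𝓞 K))
    (hnr : ∀ c : ZMod p, c ^ 3 - (a : ZMod p) * c ^ 2 + ((a : ZMod p) - 1) * c - 1 ≠ 0) :
    P = span {(p : 𝓞 K)} := by
  haveI := Fact.mk hp
  obtain ⟨Qb, hirr, hmon, hdvd, -, hspan⟩ := exists_factor_of_mem_primesOver_of_sq hθ h3 hsq hp hP
  have hfirr : Irreducible (csPolyMod a p) := by
    refine irreducible_of_degree_le_three_of_not_isRoot
      (by rw [natDegree_csPolyMod]; decide) fun c hc => hnr c ?_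
    rwa [IsRoot.def, eval_csPolyMod] at hc
  have hQb : Qb = csPolyMod a p :=
    eq_of_monic_of_associated hmon (monic_csPolyMod a p) (hirr.associated_of_dvd hfirr hdvd)
  have h := hspan (csPoly a) (by rw [hQb]; rfl)
  rw [aeval_thetaInt hθ] at h
  rw [h, Ideal.span_insert, Ideal.span_singleton_eq_bot.mpr rfl, sup_bot_eq]

/-- **Primes of residue degree one above a prime with a single root.** If `f_a` has exactly one
root `c₀` modulo `p` and `p ^ {f_P} ≤ U < p²` (so that `f_P = 1`), then a prime `P` above `p` is
`(p, θ - c₀)`: its Dedekind–Kummer factor is linear, hence `X - c₀`. [cite: Marcus2018, Ch. 3, Thm. 27] -/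
theorem eq_span_pair_of_unique_root_of_sq (hθ : aeval θ (csPoly a) = 0) (h3 : finrank ℚ K = 3)
    (hsq : ∀ r e : ℤ, csDisc a = r ^ 2 * e → 2 < |e| → IsUnit r) {p : ℕ} (hp : p.Prime)
    {P : Ideal (𝓞 K)} (hP : P ∈ primesOver (span {(p : ℤ)}) (𝓞 K)) {U : ℕ}
    (hle : p ^ P.inertiaDeg ℤ ≤ U) {c₀ : ℤ}
    (hroot : ∀ c : ZMod p, c ^ 3 - (a : ZMod p) * c ^ 2 + ((a : ZMod p) - 1) * c - 1 = 0 →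
      c = (c₀ : ZMod p))
    (hU : U < p ^ 2) :
    P = span {(p : 𝓞 K), thetaInt hθ - (c₀ : 𝓞 K)} := by
  haveI := Fact.mk hp
  obtain ⟨Qb, hirr, hmon, hdvd, hdeg, hspan⟩ :=
    exists_factor_of_mem_primesOver_of_sq hθ h3 hsq hp hP
  have hQb1 : Qb.natDegree = 1 := by
    have h1 : 1 ≤ Qb.natDegree := by
      rcases Nat.eq_zero_or_pos Qb.natDegree with h0 | h0
      · exact absurd (Polynomial.eq_one_of_monic_natDegree_zero hmon h0 ▸ isUnit_one)
          hirr.not_isUnit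
      · exact h0
    by_contra hne
    have h2 : 2 ≤ Qb.natDegree := by omega
    have : p ^ 2 ≤ p ^ P.inertiaDeg ℤ := Nat.pow_le_pow_right hp.pos (hdeg ▸ h2)
    omega
  have hQbeq : Qb = X + C (Qb.coeff 0) := hmon.eq_X_add_C hQb1
  have hc : -Qb.coeff 0 = (c₀ : ZMod p) := by
    apply hroot
    have hr : (csPolyMod a p).IsRoot (-Qb.coeff 0) := by
      rw [← dvd_iff_isRoot, map_neg, sub_neg_eq_add, ← hQbeq]
      exact hdvd
    rwa [IsRoot.def, eval_csPolyMod] at hr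
  have hQb' : (X - C c₀ : ℤ[X]).map (Int.castRingHom (ZMod p)) = Qb := by
    rw [Polynomial.map_sub, map_X, map_C, eq_intCast, ← hc, map_neg, sub_neg_eq_add, ← hQbeq]
  have hPeq := hspan (X - C c₀) hQb'
  simp only [map_sub, aeval_X, aeval_C, algebraMap_int_eq, Int.coe_castRingHom] at hPeq
  exact hPeq

/-! ### The field of `f₋₅ = x³ + 5x² - 6x - 1`: discriminant `2777` -/

/-- `Δ(f₋₅) = 2777`. [cite: AitchisonRubinstein1984, Appendix, Table 1 (row a = -5)] -/
theorem csDisc_negFive : csDisc (-5) = 2777 := by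
  decide

/-- `Δ(f₋₅) = 2777` is prime, in particular it admits no factorisation `Δ = r² e` with `|e| > 2`
and `r ≠ ±1` (Table 1, row `a = -5`: "Prime? YES"). [cite: AitchisonRubinstein1984, Appendix, Table 1 (row a = -5)] -/
theorem csDisc_negFive_sq : ∀ r e : ℤ, csDisc (-5) = r ^ 2 * e → 2 < |e| → IsUnit r :=
  isUnit_of_eq_sq_mul (B := 52) (by decide) (by decide) (by decide)

/-- **`𝓞 K = ℤ[θ]` for the trace `-5` field** (Table 1, row `a = -5`: `R = R'`). [cite: AitchisonRubinstein1984, Appendix, Table 1 (row a = -5)] -/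
theorem adjoin_thetaInt_eq_top_negFive (hθ : aeval θ (csPoly (-5)) = 0) (h3 : finrank ℚ K = 3) :
    Algebra.adjoin ℤ ({thetaInt hθ} : Set (𝓞 K)) = ⊤ :=
  adjoin_thetaInt_eq_top_of_sq hθ h3 csDisc_negFive_sq

/-- **`d_K = 2777` for the trace `-5` field** (Table 1, row `a = -5`). [cite: AitchisonRubinstein1984, Appendix, Table 1 (row a = -5)] -/
theorem discr_eq_negFive (hθ : aeval θ (csPoly (-5)) = 0) (h3 : finrank ℚ K = 3) :
    NumberField.discr K = 2777 := by
  rw [discr_eq_csDisc_of_sq hθ h3 csDisc_negFive_sq, csDisc_negFive]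

/-- The cubic relation `θ³ + 5θ² - 6θ - 1 = 0` in `𝓞 K`. [folklore] -/
theorem thetaInt_rel_negFive (hθ : aeval θ (csPoly (-5)) = 0) :
    (thetaInt hθ) ^ 3 + 5 * (thetaInt hθ) ^ 2 - 6 * thetaInt hθ - 1 = 0 := by
  have rel := thetaInt_rel hθ
  push_cast at rel
  linear_combination rel

/-! ### The primes above `2, 3, 5, 7, 11, 13` -/

/-- `2` is inert: `f₋₅ ≡ x³ + x² + 1 (mod 2)` has no root, so every prime above `2` is `(2)`. [cite: AitchisonRubinstein1984, Appendix, Example a = -5] -/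
theorem eq_span_two_negFive (hθ : aeval θ (csPoly (-5)) = 0) (h3 : finrank ℚ K = 3)
    {P : Ideal (𝓞 K)} (hP : P ∈ primesOver (span {((2 : ℕ) : ℤ)}) (𝓞 K)) :
    P = span {((2 : ℕ) : 𝓞 K)} :=
  eq_span_of_no_root_of_sq hθ h3 csDisc_negFive_sq Nat.prime_two hP (by decide)

/-- `11` is inert: `f₋₅` has no root modulo `11`, so every prime above `11` is `(11)`. [cite: AitchisonRubinstein1984, Appendix, Example a = -5] -/
theorem eq_span_eleven_negFive (hθ : aeval θ (csPoly (-5)) = 0) (h3 : finrank ℚ K = 3)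
    {P : Ideal (𝓞 K)} (hP : P ∈ primesOver (span {((11 : ℕ) : ℤ)}) (𝓞 K)) :
    P = span {((11 : ℕ) : 𝓞 K)} :=
  eq_span_of_no_root_of_sq hθ h3 csDisc_negFive_sq (by norm_num) hP (by decide)

/-- The prime of degree one above `5` is `𝔭₅ = (5, θ - 2)` (`2` is the only root of `f₋₅` mod `5`;
a prime above `5` with `5 ^ {f_P} ≤ 14` has `f_P = 1`). [cite: AitchisonRubinstein1984, Appendix, Example a = -5] -/
theorem eq_P5_negFive (hθ : aeval θ (csPoly (-5)) = 0) (h3 : finrank ℚ K = 3)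
    {P : Ideal (𝓞 K)} (hP : P ∈ primesOver (span {((5 : ℕ) : ℤ)}) (𝓞 K))
    (hle : 5 ^ P.inertiaDeg ℤ ≤ 14) :
    P = span {(5 : 𝓞 K), thetaInt hθ - 2} := by
  have h := eq_span_pair_of_unique_root_of_sq hθ h3 csDisc_negFive_sq (by norm_num) hP hle
    (c₀ := 2) (by decide) (by norm_num)
  simpa using h

/-- The prime of degree one above `7` is `𝔭₇ = (7, θ - 4)` (`4` is the only root of `f₋₅` mod `7`). [cite: AitchisonRubinstein1984, Appendix, Example a = -5] -/
theorem eq_P7_negFive (hθ : aeval θ (csPoly (-5)) = 0) (h3 : finrank ℚ K = 3)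
    {P : Ideal (𝓞 K)} (hP : P ∈ primesOver (span {((7 : ℕ) : ℤ)}) (𝓞 K))
    (hle : 7 ^ P.inertiaDeg ℤ ≤ 14) :
    P = span {(7 : 𝓞 K), thetaInt hθ - 4} := by
  have h := eq_span_pair_of_unique_root_of_sq hθ h3 csDisc_negFive_sq (by norm_num) hP hle
    (c₀ := 4) (by decide) (by norm_num)
  simpa using h

/-- The prime of degree one above `13` is `𝔭₁₃ = (13, θ - 9)` (`9` is the only root of `f₋₅`
mod `13`). [folklore] -/
theorem eq_P13_negFive (hθ : aeval θ (csPoly (-5)) = 0) (h3 : finrank ℚ K = 3)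
    {P : Ideal (𝓞 K)} (hP : P ∈ primesOver (span {((13 : ℕ) : ℤ)}) (𝓞 K))
    (hle : 13 ^ P.inertiaDeg ℤ ≤ 14) :
    P = span {(13 : 𝓞 K), thetaInt hθ - 9} := by
  have h := eq_span_pair_of_unique_root_of_sq hθ h3 csDisc_negFive_sq (by norm_num) hP hle
    (c₀ := 9) (by decide) (by norm_num)
  simpa using h

/-- `f₋₅ = (x - 2)(x² + 7x + 8) + 15` in `ℤ[x]`, whence `f₋₅ ≡ (x - 2)(x² + 7x + 8) (mod 3)`
(and `(mod 5)`). [folklore] -/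
theorem csPoly_negFive_eq :
    csPoly (-5) = (X - 2) * (X ^ 2 + 7 * X + 8) + 15 := by
  simp only [csPoly, map_neg, map_sub, map_one, map_ofNat]
  ring

/-- `f₋₅ mod 3 = (x - 2)(x² + 7x + 8)` in `𝔽₃[x]`. [folklore] -/
theorem csPolyMod_negFive_three :
    csPolyMod (-5) 3 = (X - 2) * (X ^ 2 + 7 * X + 8) := by
  rw [csPolyMod, csPoly_negFive_eq, Polynomial.map_add]
  have h15 : Polynomial.map (Int.castRingHom (ZMod 3)) (15 : ℤ[X]) = 0 := by
    rw [show (15 : ℤ[X]) = C 15 from rfl, Polynomial.map_C]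
    have : (Int.castRingHom (ZMod 3)) 15 = 0 := by decide
    rw [this, C_0]
  rw [h15, add_zero]
  simp [Polynomial.map_ofNat]

/-- The only root of `f₋₅` modulo `3` is `2`. [folklore] -/
theorem root_three_negFive :
    ∀ c : ZMod 3, c ^ 3 - ((-5 : ℤ) : ZMod 3) * c ^ 2 + (((-5 : ℤ) : ZMod 3) - 1) * c - 1 = 0 →
      c = ((2 : ℤ) : ZMod 3) := by
  decide

/-- **The two primes above `3`**: `f₋₅ ≡ (x - 2)(x² + 7x + 8) (mod 3)` with both factors
irreducible, so a prime `P` above `3` with `3 ^ {f_P} ≤ 14` (i.e. `f_P ≤ 2`) is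
`𝔭₃ = (3, θ - 2)` (degree one) or `𝔭₉ = (3, θ² + 7θ + 8)` (degree two). [cite: AitchisonRubinstein1984, Appendix, Example a = -5] -/
theorem eq_P3_or_eq_P9_negFive (hθ : aeval θ (csPoly (-5)) = 0) (h3 : finrank ℚ K = 3)
    {P : Ideal (𝓞 K)} (hP : P ∈ primesOver (span {((3 : ℕ) : ℤ)}) (𝓞 K))
    (hle : 3 ^ P.inertiaDeg ℤ ≤ 14) :
    P = span {(3 : 𝓞 K), thetaInt hθ - 2} ∨
      P = span {(3 : 𝓞 K), (thetaInt hθ) ^ 2 + 7 * thetaInt hθ + 8} := by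
  haveI := Fact.mk Nat.prime_three
  obtain ⟨Qb, hirr, hmon, hdvd, hdeg, hspan⟩ :=
    exists_factor_of_mem_primesOver_of_sq hθ h3 csDisc_negFive_sq Nat.prime_three hP
  -- `1 ≤ f_P ≤ 2`
  have hf2 : Qb.natDegree ≤ 2 := by
    by_contra hlt
    have h3le : 3 ≤ P.inertiaDeg ℤ := by rw [hdeg]; omega
    have : 3 ^ 3 ≤ 3 ^ P.inertiaDeg ℤ := Nat.pow_le_pow_right (by norm_num) h3le
    omega
  have hf1 : 1 ≤ Qb.natDegree := by
    rcases Nat.eq_zero_or_pos Qb.natDegree with h0 | h0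
    · exact absurd (Polynomial.eq_one_of_monic_natDegree_zero hmon h0 ▸ isUnit_one) hirr.not_isUnit
    · exact h0
  have hgmon : (X ^ 2 + 7 * X + 8 : (ZMod 3)[X]).Monic := by
    monicity!
  have hgdeg : (X ^ 2 + 7 * X + 8 : (ZMod 3)[X]).natDegree = 2 := by
    compute_degree!
  rw [csPolyMod_negFive_three] at hdvd
  rcases (show Qb.natDegree = 1 ∨ Qb.natDegree = 2 by omega) with h1 | h2
  · -- degree one: the root is `2`
    left
    have hQbeq : Qb = X + C (Qb.coeff 0) := hmon.eq_X_add_C h1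
    have hc : -Qb.coeff 0 = ((2 : ℤ) : ZMod 3) := by
      apply root_three_negFive
      have hr : (csPolyMod (-5) 3).IsRoot (-Qb.coeff 0) := by
        rw [← dvd_iff_isRoot, map_neg, sub_neg_eq_add, ← hQbeq, csPolyMod_negFive_three]
        exact hdvd
      rwa [IsRoot.def, eval_csPolyMod] at hr
    have hQb' : (X - C (2 : ℤ) : ℤ[X]).map (Int.castRingHom (ZMod 3)) = Qb := by
      rw [Polynomial.map_sub, map_X, map_C, eq_intCast, ← hc, map_neg, sub_neg_eq_add, ← hQbeq]
    have hPeq := hspan (X - C (2 : ℤ)) hQb'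
    simp only [map_sub, aeval_X, aeval_C, algebraMap_int_eq, Int.coe_castRingHom] at hPeq
    simpa using hPeq
  · -- degree two: `Qb = x² + 7x + 8`
    right
    have hprime : Prime Qb := hirr.prime
    have hQg : Qb = X ^ 2 + 7 * X + 8 := by
      rcases hprime.dvd_or_dvd hdvd with hd | hd
      · exfalso
        have hne : (X - 2 : (ZMod 3)[X]) ≠ 0 :=
          (show (X - 2 : (ZMod 3)[X]).Monic by monicity!).ne_zero
        have hle1 := Polynomial.natDegree_le_of_dvd hd hne
        have hd1 : (X - 2 : (ZMod 3)[X]).natDegree = 1 := by compute_degree!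
        omega
      · exact (Polynomial.eq_of_monic_of_dvd_of_natDegree_le hmon hgmon hd (by omega)).symm
    have hQb' : (X ^ 2 + C 7 * X + C 8 : ℤ[X]).map (Int.castRingHom (ZMod 3)) = Qb := by
      rw [hQg]
      simp [Polynomial.map_ofNat]
    have hPeq := hspan (X ^ 2 + C 7 * X + C 8) hQb'
    simp only [map_add, map_mul, map_pow, aeval_X, aeval_C, algebraMap_int_eq,
      Int.coe_castRingHom] at hPeq
    simpa using hPeq

/-! ### Products of the small primes: explicit generators -/

/-- **Certificate for `(a, b)(c, d) = (β)`**: it suffices that `β` divides the four products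
`ac, ad, bc, bd` and is a combination of them. [folklore] -/
theorem span_pair_mul_span_pair_eq_span_singleton {R : Type*} [CommRing R]
    {a b c d β δ₁ δ₂ δ₃ δ₄ u₁ u₂ u₃ u₄ : R}
    (h1 : a * c = β * δ₁) (h2 : a * d = β * δ₂) (h3 : b * c = β * δ₃) (h4 : b * d = β * δ₄)
    (h : β = u₁ * (a * c) + u₂ * (a * d) + u₃ * (b * c) + u₄ * (b * d)) :
    span {a, b} * span {c, d} = span ({β} : Set R) := by
  rw [Ideal.span_pair_mul_span_pair]
  apply le_antisymm
  · rw [Ideal.span_le]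
    rintro x hx
    simp only [Set.mem_insert_iff, Set.mem_singleton_iff] at hx
    rcases hx with rfl | rfl | rfl | rfl
    · exact Ideal.mem_span_singleton'.mpr ⟨δ₁, by rw [mul_comm]; exact h1.symm⟩
    · exact Ideal.mem_span_singleton'.mpr ⟨δ₂, by rw [mul_comm]; exact h2.symm⟩
    · exact Ideal.mem_span_singleton'.mpr ⟨δ₃, by rw [mul_comm]; exact h3.symm⟩
    · exact Ideal.mem_span_singleton'.mpr ⟨δ₄, by rw [mul_comm]; exact h4.symm⟩
  · rw [Ideal.span_singleton_le_iff_mem, h]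
    refine Ideal.add_mem _ (Ideal.add_mem _ (Ideal.add_mem _ ?_ ?_) ?_) ?_
    · exact Ideal.mul_mem_left _ _ (Ideal.subset_span (by simp))
    · exact Ideal.mul_mem_left _ _ (Ideal.subset_span (by simp))
    · exact Ideal.mul_mem_left _ _ (Ideal.subset_span (by simp))
    · exact Ideal.mul_mem_left _ _ (Ideal.subset_span (by simp))

/-- **`𝔭₅² = (2θ + 1)`** (`N(2θ + 1) = -25`): `25 = (2θ+1)(33 - 18θ - 4θ²)`,
`5(θ-2) = (2θ+1)(-14 + 9θ + 2θ²)`, `(θ-2)² = (2θ+1)(6 - 4θ - θ²)`, and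
`2θ + 1 = (2θ - 2θ²)·25 - (1 + θ)·5(θ - 2) + θ²·(θ - 2)²`. In particular `[𝔭₅]² = 1`. [cite: AitchisonRubinstein1984, Appendix, Example a = -5] -/
theorem P5_mul_P5_negFive (hθ : aeval θ (csPoly (-5)) = 0) :
    span {(5 : 𝓞 K), thetaInt hθ - 2} * span {(5 : 𝓞 K), thetaInt hθ - 2} =
      span {2 * thetaInt hθ + 1} := by
  have rel := thetaInt_rel_negFive hθ
  set t := thetaInt hθ with ht
  exact span_pair_mul_span_pair_eq_span_singleton
    (δ₁ := 33 - 18 * t - 4 * t ^ 2) (δ₂ := -14 + 9 * t + 2 * t ^ 2)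
    (δ₃ := -14 + 9 * t + 2 * t ^ 2) (δ₄ := 6 - 4 * t - t ^ 2)
    (u₁ := 2 * t - 2 * t ^ 2) (u₂ := 0) (u₃ := -1 - t) (u₄ := t ^ 2)
    (by linear_combination (8 : 𝓞 K) * rel) (by linear_combination (-4 : 𝓞 K) * rel)
    (by linear_combination (-4 : 𝓞 K) * rel) (by linear_combination (2 : 𝓞 K) * rel)
    (by linear_combination (9 - t) * rel)

/-- **`𝔭₃ 𝔭₅ = (θ - 2)`** (`N(θ - 2) = -15`): `15 = (θ-2)(-8 - 7θ - θ²)` and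
`θ - 2 = 2·3(θ-2) - 5(θ-2)`. In particular `[𝔭₃] = [𝔭₅]⁻¹`. [cite: AitchisonRubinstein1984, Appendix, Example a = -5] -/
theorem P3_mul_P5_negFive (hθ : aeval θ (csPoly (-5)) = 0) :
    span {(3 : 𝓞 K), thetaInt hθ - 2} * span {(5 : 𝓞 K), thetaInt hθ - 2} =
      span {thetaInt hθ - 2} := by
  have rel := thetaInt_rel_negFive hθ
  set t := thetaInt hθ with ht
  exact span_pair_mul_span_pair_eq_span_singleton
    (δ₁ := -8 - 7 * t - t ^ 2) (δ₂ := 3) (δ₃ := 5) (δ₄ := t - 2)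
    (u₁ := 0) (u₂ := 2) (u₃ := -1) (u₄ := 0)
    (by linear_combination (1 : 𝓞 K) * rel) (by ring) (by ring) (by ring) (by ring)

/-- **`𝔭₅ 𝔭₇ = (θ + 3)`** (`N(θ + 3) = -35`): `35 = (θ+3)(12 - 2θ - θ²)`,
`5(θ-4) = (θ+3)(-7 + 2θ + θ²)`, `7(θ-2) = (θ+3)(-5 + 2θ + θ²)`, `(θ-2)(θ-4) = (θ+3)(3 - θ - θ²)`,
and `θ + 3 = θ²·5(θ-4) - 2θ·7(θ-2) + (1 + θ + θ²)(θ-2)(θ-4)`. In particular `[𝔭₇] = [𝔭₅]⁻¹`. [cite: AitchisonRubinstein1984, Appendix, Example a = -5] -/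
theorem P5_mul_P7_negFive (hθ : aeval θ (csPoly (-5)) = 0) :
    span {(5 : 𝓞 K), thetaInt hθ - 2} * span {(7 : 𝓞 K), thetaInt hθ - 4} =
      span {thetaInt hθ + 3} := by
  have rel := thetaInt_rel_negFive hθ
  set t := thetaInt hθ with ht
  exact span_pair_mul_span_pair_eq_span_singleton
    (δ₁ := 12 - 2 * t - t ^ 2) (δ₂ := -7 + 2 * t + t ^ 2)
    (δ₃ := -5 + 2 * t + t ^ 2) (δ₄ := 3 - t - t ^ 2)
    (u₁ := 0) (u₂ := t ^ 2) (u₃ := -2 * t) (u₄ := 1 + t + t ^ 2)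
    (by linear_combination (1 : 𝓞 K) * rel) (by linear_combination (-1 : 𝓞 K) * rel)
    (by linear_combination (-1 : 𝓞 K) * rel) (by linear_combination (1 : 𝓞 K) * rel)
    (by linear_combination (5 - t) * rel)

/-- **`𝔭₅ 𝔭₁₃ = (3θ - 1)`** (`N(3θ - 1) = 65`): `65 = (3θ-1)(-38 + 48θ + 9θ²)`,
`5(θ-9) = (3θ-1)(27 - 32θ - 6θ²)`, `13(θ-2) = (3θ-1)(17 - 16θ - 3θ²)`,
`(θ-2)(θ-9) = (3θ-1)(-12 + 11θ + 2θ²)`, and `3θ - 1 = -65 - 2·5(θ-9) + 13(θ-2)`. In particular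
`[𝔭₁₃] = [𝔭₅]⁻¹`. [folklore] -/
theorem P5_mul_P13_negFive (hθ : aeval θ (csPoly (-5)) = 0) :
    span {(5 : 𝓞 K), thetaInt hθ - 2} * span {(13 : 𝓞 K), thetaInt hθ - 9} =
      span {3 * thetaInt hθ - 1} := by
  have rel := thetaInt_rel_negFive hθ
  set t := thetaInt hθ with ht
  exact span_pair_mul_span_pair_eq_span_singleton
    (δ₁ := -38 + 48 * t + 9 * t ^ 2) (δ₂ := 27 - 32 * t - 6 * t ^ 2)
    (δ₃ := 17 - 16 * t - 3 * t ^ 2) (δ₄ := -12 + 11 * t + 2 * t ^ 2)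
    (u₁ := -1) (u₂ := -2) (u₃ := 1) (u₄ := 0)
    (by linear_combination (-27 : 𝓞 K) * rel) (by linear_combination (18 : 𝓞 K) * rel)
    (by linear_combination (9 : 𝓞 K) * rel) (by linear_combination (-6 : 𝓞 K) * rel)
    (by ring)

/-- **`𝔭₃ 𝔭₉ = (3)`**: `(θ - 2)(θ² + 7θ + 8) = f₋₅(θ) - 15 = -15` and `3 = 2·9 - 15`. In
particular `[𝔭₉] = [𝔭₃]⁻¹`. [cite: AitchisonRubinstein1984, Appendix, Example a = -5] -/
theorem P3_mul_P9_negFive (hθ : aeval θ (csPoly (-5)) = 0) :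
    span {(3 : 𝓞 K), thetaInt hθ - 2} * span {(3 : 𝓞 K), (thetaInt hθ) ^ 2 + 7 * thetaInt hθ + 8} =
      span {(3 : 𝓞 K)} := by
  have rel := thetaInt_rel_negFive hθ
  set t := thetaInt hθ with ht
  exact span_pair_mul_span_pair_eq_span_singleton
    (δ₁ := 3) (δ₂ := t ^ 2 + 7 * t + 8) (δ₃ := t - 2) (δ₄ := -5)
    (u₁ := 2) (u₂ := 0) (u₃ := 0) (u₄ := 1)
    (by ring) (by ring) (by ring) (by linear_combination (1 : 𝓞 K) * rel)
    (by linear_combination (-1 : 𝓞 K) * rel)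

end Root


/-! ### The class group: every class is `1` or `[𝔭₅]` -/

section ClassGroup

open scoped nonZeroDivisors

variable {K : Type*} [Field K] [NumberField K] {θ : K}

/-- **Generation of the class group by small primes** (the standard consequence of the Minkowski
bound; Marcus, *Number Fields*, Ch. 5, Cor. 2 of Thm. 37 and the discussion following it). If
`⌊M_K⌋ ≤ U` and a subgroup `H` of the class group contains the class of every prime `P` above a
rational prime `p ≤ U` with `p ^ {f_P} ≤ U`, then `H` is the whole class group: every class
contains an integral ideal of norm `≤ M_K`, which is a product of such primes. (Mathlib's
`RingOfIntegers.isPrincipalIdealRing_of_isPrincipal_of_pow_le_of_mem_primesOver_of_mem_Icc` is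
the case `H = 1`; the proof below is its proof with `H` in place of the principal classes.) [cite: Marcus2018, Ch. 5, Cor. 2 of Thm. 37] -/
theorem classGroup_subgroup_eq_top_of_primesOver (H : Subgroup (ClassGroup (𝓞 K))) {U : ℕ}
    (hU : ⌊(4 / Real.pi) ^ NumberField.InfinitePlace.nrComplexPlaces K *
        ((finrank ℚ K).factorial / (finrank ℚ K : ℝ) ^ finrank ℚ K *
          Real.sqrt |(NumberField.discr K : ℝ)|)⌋₊ ≤ U)
    (h : ∀ p ∈ Finset.Icc 1 U, p.Prime → ∀ (P : Ideal (𝓞 K)) (hP0 : P ∈ (Ideal (𝓞 K))⁰),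
      P ∈ primesOver (span {(p : ℤ)}) (𝓞 K) → p ^ P.inertiaDeg ℤ ≤ U →
        ClassGroup.mk0 ⟨P, hP0⟩ ∈ H) :
    H = ⊤ := by
  classical
  -- Step 1: every nonzero prime of norm `≤ U` has its class in `H`.
  have hprimeMem : ∀ (P : Ideal (𝓞 K)) (hP0 : P ∈ (Ideal (𝓞 K))⁰), P.IsPrime →
      absNorm P ≤ U → ClassGroup.mk0 ⟨P, hP0⟩ ∈ H := by
    intro P HP hP hPN
    obtain ⟨p, hp⟩ := IsPrincipalIdealRing.principal <| under ℤ P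
    have hp0 : p ≠ 0 := fun h0 ↦ nonZeroDivisors.coe_ne_zero ⟨P, HP⟩ <|
      eq_bot_of_comap_eq_bot (R := ℤ) <| by
        simpa only [hp, submodule_span_eq, span_singleton_eq_bot]
    have hpprime := (span_singleton_prime hp0).mp
    simp only [← submodule_span_eq, ← hp] at hpprime
    have hlies : P.LiesOver (span {p}) := by
      rcases abs_choice p with habs | habs <;>
      simpa [habs, span_singleton_neg p, ← submodule_span_eq, ← hp] using over_under P
    have hspan : span {↑p.natAbs} = span {p} := by
      rcases abs_choice p with habs | habs <;> simp [habs]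
    have hpabsprime := Int.prime_iff_natAbs_prime.mp (hpprime (hP.under _))
    have hlies' : P.LiesOver (span {((p.natAbs : ℕ) : ℤ)}) := hspan ▸ hlies
    have hple : p.natAbs ^ P.inertiaDeg ℤ ≤ U := by
      haveI := hP
      rw [Ideal.pow_inertiaDeg p.natAbs P]
      exact hPN
    refine h _ ?_ hpabsprime P HP ⟨hP, hlies'⟩ hple
    have hf0 : 0 < P.inertiaDeg ℤ := by
      haveI := hP
      have := (isPrime_of_prime (prime_span_singleton_iff.mpr <|
        hpprime (hP.under _))).isMaximal <| by simp [((hpprime (hP.under _))).ne_zero]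
      exact inertiaDeg_pos ..
    exact Finset.mem_Icc.mpr ⟨hpabsprime.one_le, le_trans (Nat.le_self_pow hf0.ne' _) hple⟩
  -- Step 2: products of such primes.
  have hprod : ∀ s : Multiset (Ideal (𝓞 K)), (∀ J ∈ s, J.IsPrime ∧ J ≠ ⊥ ∧ absNorm J ≤ U) →
      ∀ hs0 : s.prod ∈ (Ideal (𝓞 K))⁰, ClassGroup.mk0 ⟨s.prod, hs0⟩ ∈ H := by
    intro s
    induction s using Multiset.induction_on with
    | empty =>
      intro _ hs0
      have : (⟨(0 : Multiset (Ideal (𝓞 K))).prod, hs0⟩ : (Ideal (𝓞 K))⁰) = 1 :=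
        Subtype.ext (by simp)
      rw [this, map_one]
      exact H.one_mem
    | cons J s ih =>
      intro hall hs0
      have hJ := hall J (Multiset.mem_cons_self J s)
      have hJ0 : J ∈ (Ideal (𝓞 K))⁰ := mem_nonZeroDivisors_iff_ne_zero.mpr hJ.2.1
      have hs0' : s.prod ∈ (Ideal (𝓞 K))⁰ := by
        refine mem_nonZeroDivisors_iff_ne_zero.mpr fun h0 => ?_
        have : (J ::ₘ s).prod = 0 := by rw [Multiset.prod_cons, h0, mul_zero]
        exact nonZeroDivisors.ne_zero hs0 this
      have heq : (⟨(J ::ₘ s).prod, hs0⟩ : (Ideal (𝓞 K))⁰) = ⟨J, hJ0⟩ * ⟨s.prod, hs0'⟩ :=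
        Subtype.ext (by simp [Multiset.prod_cons])
      rw [heq, map_mul]
      exact H.mul_mem (hprimeMem J hJ0 hJ.1 hJ.2.2)
        (ih (fun J' hJ' => hall J' (Multiset.mem_cons_of_mem hJ')) hs0')
  -- Step 3: every class contains an ideal of norm `≤ U`.
  rw [Subgroup.eq_top_iff']
  intro C
  obtain ⟨I, rfl, hI⟩ := NumberField.exists_ideal_in_class_of_norm_le C
  have hIU : absNorm (I : Ideal (𝓞 K)) ≤ U := by
    refine le_trans (Nat.le_floor hI) hU
  have hI0 : (I : Ideal (𝓞 K)) ≠ ⊥ := nonZeroDivisors.coe_ne_zero I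
  have hfac := Ideal.prod_normalizedFactors_eq_self hI0
  have key := hprod (UniqueFactorizationMonoid.normalizedFactors (I : Ideal (𝓞 K)))
    (fun J hJ => ?_) (by rw [hfac]; exact I.2)
  · have : (⟨(UniqueFactorizationMonoid.normalizedFactors (I : Ideal (𝓞 K))).prod,
        by rw [hfac]; exact I.2⟩ : (Ideal (𝓞 K))⁰) = I := Subtype.ext hfac
    rwa [this] at key
  · have hJp : J.IsPrime :=
      ((Ideal.mem_normalizedFactors_iff hI0).mp hJ).1
    have hJdvd : J ∣ (I : Ideal (𝓞 K)) := UniqueFactorizationMonoid.dvd_of_mem_normalizedFactors hJ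
    refine ⟨hJp, ?_, ?_⟩
    · rintro rfl
      exact hI0 (eq_bot_iff.mpr ((Ideal.dvd_iff_le).mp hJdvd) |>.symm ▸ rfl)
    · exact le_trans (Nat.le_of_dvd (Nat.pos_of_ne_zero (absNorm_ne_zero_of_nonZeroDivisors I))
        (absNorm_dvd_absNorm_of_le ((Ideal.dvd_iff_le).mp hJdvd))) hIU

/-- An ideal `(n, x)` with `n` a nonzero natural number is a nonzero ideal. [folklore] -/
theorem span_pair_natCast_mem_nonZeroDivisors {n : ℕ} (hn : n ≠ 0) (x : 𝓞 K) :
    span {(n : 𝓞 K), x} ∈ (Ideal (𝓞 K))⁰ := by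
  refine mem_nonZeroDivisors_iff_ne_zero.mpr fun h0 => ?_
  have hmem : (n : 𝓞 K) ∈ span {(n : 𝓞 K), x} := Ideal.subset_span (by simp)
  rw [h0] at hmem
  have : (n : 𝓞 K) = 0 := by simpa using hmem
  exact hn (by exact_mod_cast this)

/-- `𝔭₅ = (5, θ - 2)` is a nonzero ideal. [folklore] -/
theorem P5_mem_nonZeroDivisors_negFive (hθ : aeval θ (csPoly (-5)) = 0) :
    span {(5 : 𝓞 K), thetaInt hθ - 2} ∈ (Ideal (𝓞 K))⁰ := by
  have h := span_pair_natCast_mem_nonZeroDivisors (K := K) (n := 5) (Nat.succ_ne_zero 4)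
    (thetaInt hθ - 2)
  simp only [Nat.cast_ofNat] at h
  exact h

/-- **Every ideal class of the trace `-5` field is `1` or `[𝔭₅]`, and `[𝔭₅]² = 1`** (so the
class number is at most `2`; Aitchison–Rubinstein, Table 1, row `a = -5`: `|C(R')| = 2`, and
Example `a = -5`: the class group is `{[B₃], [B₅], [B₇]}`-generated of order `2`). Proof: `⌊M_K⌋ ≤ 14`
(`d_K = 2777`, `r₂ ≤ 1`); the primes `P` above `p ≤ 14` with `p ^ {f_P} ≤ 14` are `(2)`, `(11)`,
`𝔭₃, 𝔭₉, 𝔭₅, 𝔭₇, 𝔭₁₃`, whose classes lie in the subgroup generated by `[𝔭₅]` by the relations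
`𝔭₃ 𝔭₅ = (θ - 2)`, `𝔭₃ 𝔭₉ = (3)`, `𝔭₅ 𝔭₇ = (θ + 3)`, `𝔭₅ 𝔭₁₃ = (3θ - 1)`; and `𝔭₅² = (2θ + 1)`. [cite: AitchisonRubinstein1984, Appendix, Table 1 (row a = -5) and Example a = -5] -/
theorem classGroup_mem_pair_negFive (hθ : aeval θ (csPoly (-5)) = 0) (h3 : finrank ℚ K = 3)
    (C : ClassGroup (𝓞 K)) :
    C = 1 ∨ C = ClassGroup.mk0 ⟨span {(5 : 𝓞 K), thetaInt hθ - 2}, P5_mem_nonZeroDivisors_negFive hθ⟩ := by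
  classical
  set c5 : ClassGroup (𝓞 K) :=
    ClassGroup.mk0 ⟨span {(5 : 𝓞 K), thetaInt hθ - 2}, P5_mem_nonZeroDivisors_negFive hθ⟩ with hc5
  have rel := thetaInt_rel_negFive hθ
  set t := thetaInt hθ with ht
  -- nonvanishing: an element dividing a nonzero rational integer is nonzero
  have hne : ∀ (x y : 𝓞 K) (n : ℕ), x * y = n → n ≠ 0 → x ≠ 0 := by
    rintro x y n hxy hn rfl
    rw [zero_mul] at hxy
    exact hn (by exact_mod_cast hxy.symm)
  have hne1 : 2 * t + 1 ≠ 0 :=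
    hne _ (33 - 18 * t - 4 * t ^ 2) 25 (by push_cast; linear_combination (-8 : 𝓞 K) * rel)
      (by norm_num)
  have hne2 : t - 2 ≠ 0 :=
    hne _ (-8 - 7 * t - t ^ 2) 15 (by push_cast; linear_combination (-1 : 𝓞 K) * rel) (by norm_num)
  have hne3 : t + 3 ≠ 0 :=
    hne _ (12 - 2 * t - t ^ 2) 35 (by push_cast; linear_combination (-1 : 𝓞 K) * rel) (by norm_num)
  have hne4 : 3 * t - 1 ≠ 0 :=
    hne _ (-38 + 48 * t + 9 * t ^ 2) 65 (by push_cast; linear_combination (27 : 𝓞 K) * rel)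
      (by norm_num)
  -- the order-two relation `[𝔭₅]² = 1`
  have hsq : c5 * c5 = 1 := by
    have h : c5 = c5⁻¹ :=
      ClassGroup.mk0_eq_mk0_inv_iff.mpr ⟨2 * t + 1, hne1, by simpa using P5_mul_P5_negFive hθ⟩
    rwa [eq_inv_iff_mul_eq_one] at h
  -- the subgroup generated by `c5` contains the classes of all small primes
  let H : Subgroup (ClassGroup (𝓞 K)) := Subgroup.zpowers c5
  have hc5H : c5 ∈ H := Subgroup.mem_zpowers c5
  have hinvH : ∀ (P : Ideal (𝓞 K)) (hP0 : P ∈ (Ideal (𝓞 K))⁰) (x : 𝓞 K), x ≠ 0 →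
      P * span {(5 : 𝓞 K), t - 2} = span {x} → ClassGroup.mk0 ⟨P, hP0⟩ ∈ H := by
    intro P hP0 x hx hPx
    have : ClassGroup.mk0 ⟨P, hP0⟩ = c5⁻¹ :=
      ClassGroup.mk0_eq_mk0_inv_iff.mpr ⟨x, hx, by simpa using hPx⟩
    rw [this]
    exact H.inv_mem hc5H
  have hprinc : ∀ (P : Ideal (𝓞 K)) (hP0 : P ∈ (Ideal (𝓞 K))⁰) (x : 𝓞 K), P = span {x} →
      ClassGroup.mk0 ⟨P, hP0⟩ ∈ H := by
    intro P hP0 x hPx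
    have : ClassGroup.mk0 ⟨P, hP0⟩ = 1 :=
      (ClassGroup.mk0_eq_one_iff hP0).mpr ⟨⟨x, by rw [hPx, submodule_span_eq]⟩⟩
    rw [this]
    exact H.one_mem
  have hP3 : span {(3 : 𝓞 K), t - 2} ∈ (Ideal (𝓞 K))⁰ := by
    have h := span_pair_natCast_mem_nonZeroDivisors (K := K) (n := 3) (Nat.succ_ne_zero 2) (t - 2)
    simp only [Nat.cast_ofNat] at h
    exact h
  have hP3inv : ClassGroup.mk0 ⟨span {(3 : 𝓞 K), t - 2}, hP3⟩ = c5⁻¹ :=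
    ClassGroup.mk0_eq_mk0_inv_iff.mpr ⟨t - 2, hne2, by simpa using P3_mul_P5_negFive hθ⟩
  -- Minkowski: `⌊M_K⌋ ≤ 14`
  have hd : ((|NumberField.discr K| : ℤ) : ℝ) ≤ (2777 : ℕ) := by
    rw [discr_eq_negFive hθ h3]
    norm_num
  have hfloor := floor_minkowskiBound_le_cubic h3 hd (s := 52.7) (U := 14) (by norm_num)
    (by norm_num) (by norm_num)
  have htop : H = ⊤ := by
    refine classGroup_subgroup_eq_top_of_primesOver H hfloor fun p hp hprime P hP0 hP hle => ?_
    have hpU : p ≤ 14 := (Finset.mem_Icc.mp hp).2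
    have h1p : 1 ≤ p := (Finset.mem_Icc.mp hp).1
    interval_cases p
    · exact absurd hprime (by decide)
    · exact hprinc P hP0 _ (eq_span_two_negFive hθ h3 hP)
    · rcases eq_P3_or_eq_P9_negFive hθ h3 hP hle with h3' | h9
      · -- `[𝔭₃] = [𝔭₅]⁻¹`
        exact hinvH P hP0 (t - 2) hne2 (by rw [h3']; exact P3_mul_P5_negFive hθ)
      · -- `[𝔭₉] = [𝔭₃]⁻¹ = [𝔭₅]`
        have h9inv : ClassGroup.mk0 ⟨P, hP0⟩ = (ClassGroup.mk0 ⟨span {(3 : 𝓞 K), t - 2}, hP3⟩)⁻¹ := by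
          refine ClassGroup.mk0_eq_mk0_inv_iff.mpr ⟨3, by norm_num, ?_⟩
          have := P3_mul_P9_negFive hθ
          rw [mul_comm] at this
          simpa [h9] using this
        rw [h9inv, hP3inv, inv_inv]
        exact hc5H
    · exact absurd hprime (by decide)
    · have h5 := eq_P5_negFive hθ h3 hP hle
      subst h5
      exact hc5H
    · exact absurd hprime (by decide)
    · have h7 := eq_P7_negFive hθ h3 hP hle
      refine hinvH P hP0 (t + 3) hne3 ?_
      rw [h7, mul_comm]
      exact P5_mul_P7_negFive hθ
    · exact absurd hprime (by decide)
    · exact absurd hprime (by decide)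
    · exact absurd hprime (by decide)
    · exact hprinc P hP0 _ (eq_span_eleven_negFive hθ h3 hP)
    · exact absurd hprime (by decide)
    · have h13 := eq_P13_negFive hθ h3 hP hle
      refine hinvH P hP0 (3 * t - 1) hne4 ?_
      rw [h13, mul_comm]
      exact P5_mul_P13_negFive hθ
    · exact absurd hprime (by decide)
  -- conclusion from `H = ⊤` and `c5² = 1`
  have hC : C ∈ H := by rw [htop]; exact Subgroup.mem_top C
  obtain ⟨k, rfl⟩ := Subgroup.mem_zpowers_iff.mp hC
  have h2 : c5 ^ (2 : ℤ) = 1 := by rw [zpow_two]; exact hsq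
  obtain ⟨j, rfl | rfl⟩ := Int.even_or_odd' k
  · left
    rw [zpow_mul, h2, one_zpow]
  · right
    rw [zpow_add, zpow_mul, h2, one_zpow, one_mul, zpow_one]

end ClassGroup

end Literature.Topology.FourManifolds

end
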